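import Summits.QuantumFields.BalabanUV.Gaps.D1BinderEnds
import Summits.QuantumFields.BalabanUV.Gaps.D1CumJcFree
import Summits.QuantumFields.BalabanUV.Beta.CombOneShotJets
import Summits.QuantumFields.BalabanUV.Gaps.D4Residue

/-!
# `BalabanUV.Gaps.D1Residue` — cell `pub-balaban-gaps` (YM blitz Y1), track G1, seat g1-p1: **THE RESIDUE OF BINDER (D1) AS NAMED `Prop`S** —
# `ReadoutBdd` (the `O(1)`-tolerant telescoping clause), `OneShotLaw` (the scheme-free one-shot one-loop law = the exact missing lemma), `Residue`
# (their conjunction over some composite jet partner), `D1Cum` (g1-plan-2's Jc-free scalar, SK-D1c) — with the ENDs of `Gaps.D1BinderEnds` ∕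
# `Gaps.D1CumJcFree` restated BY NAME, and the RIGIDITY of the slope

HONEST FRAMING (page 1, cell contract).  WHAT THIS IS: the STATEMENT FILE of the cell's row (D1) — four `Prop`-valued PREDICATES over jet parameters ∕ real
sequences (never facts; nothing is asserted of Bałaban's jets) and one-line restatements of the [folklore] theorems of `Gaps.D1BinderEnds` and `Gaps.D1CumJcFree`
in their terms, so that `HOME/BALABAN-GAPS.md` can name the residue by a Lean identifier.  WHAT THIS IS NOT: not a proof of (D1); nothing of Bałaban's papers
asserted or discharged; [B12] Theorem 2 (T. Bałaban, CMP 109 (1987), p. 259) is printed WITHOUT proof and proved nowhere in print ([B16] p. 355); NOT `BetaPertH`,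
NOT the continuum limit, NOT Clay.  HONEST DEPENDENCY (verbatim): continuum YM on T⁴ ⇐ BetaPertH ∧ nine spine estimates (0/9 proved); BetaPertH ⇐ (D1) ∧ (D4) ∧
CAP+tail; G-an2-4 gates asym, D1 and NE2/3/4.

WHY A SUMMITS FILE WITH `def … : Prop`: the predicates are OUR cut of OUR typed binder (no published statement to cite), so the Literature lane (published
statements only, `lint.literature-cited-only`) is not their home; they sit next to their consumers, tagged [folklore], exactly as the β sub-cell's own
`D1Tel`/`D1Rep`/`D1Drift` are predicates over jet parameters «never facts».  They RESTATE NOTHING: `ReadoutBdd` names the inline hypothesis `hbdd` of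
`Beta.RowD1TelescopingBounded` §1 ∕ `Gaps.D1BinderEnds` §1, `OneShotLaw` is new (the `D1Rep`-free, window-free, table-free form of the one-shot comparison),
`Residue` is their conjunction, `D1Cum` is g1-plan-2's Jc-free scalar (SK-D1c 616d46648e8c3a63) — the inline hypothesis `hcum` of `Gaps.D1CumJcFree`.

THE FOUR PREDICATES.
* `ReadoutBdd Lc Js Jc μ ν := ∃ U′, ∀ m ≥ 1, |Σ_{j<m} secondMoment (TbalOf Lc Js j) μ ν − secondMoment (TshotOf Lc Jc m) μ ν| ≤ U′`.
* `OneShotLaw Lc Jc N μ ν := ∃ U, ∀ m ≥ 1, |secondMoment (TshotOf Lc Jc m) μ ν − m · stepBal N Lc| ≤ U` (`= (11N²/12π²)·log (Lc^m) + O(1)`).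
* `Residue Lc Js N μ ν := ∃ Jc, ReadoutBdd Lc Js Jc μ ν ∧ OneShotLaw Lc Jc N μ ν`.
* `D1Cum Lc β0 N μ ν a SL k := ∃ U, ∀ m ≥ 1, |Σ_{j<m} β0 j − oneShotSide SL μ ν N a k (Lc^m)| ≤ U` (SK-D1c's shape over a real sequence).
THE WEB (all [folklore], one-liners over the two kernel files): two out of three among {(D1), `ReadoutBdd`, `OneShotLaw`} (so (D1) ⟺ `OneShotLaw` given a telescoping
partner; `Residue ⟺ (D1) ∧ ∃ Jc, ReadoutBdd`); `OneShotLaw ⟺ D1Rep` and `(D1) ⟺ D1Cum` under the two PRINTED [B5] statements BY NAME; `D1Tel + hW + hR ⟹ ReadoutBdd`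
(exact read-out identity); the record-literal ENDs, incl. the FULLY PINNED form at an2's composite one-shot jets of record `CombOneShotJets.JcOf`
(`d1Drift_record_iff_oneShotLaw_JcOf`); the JOINT END with row (D4)'s named residue `AtSlope` (g1-p2's `Gaps.D4Residue`):
`endpointExistence_of_residue_atSlope`; and the RIGIDITY of the slope (`oneLoopDrift_slope_unique`, `d1Drift_slope_unique`: a sequence drifts with at most
ONE slope, so (D1) pins the one-loop number `(11N²/12π²)·log Lc` — any other slope is refuted by it; `d1Drift_colour_sq_unique`: (D1) for the same
step family with two colour numerals forces `Nc² = Nc'²` — the numeral's identification with the jets' colour content is part of the wall).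

ABSOLUTE RULE (cell charter, verbatim): «No internally-minted statement may enter as a cited fact. Every hypothesis is either kernel-proved in this package or a
verbatim quotation of a PUBLISHED theorem with page reference.»  Nothing below is cited or asserted; the only `def`s are the four predicates; no `sorry`; axioms ⊆
the standard trio.  Provenance: cell pub-balaban-gaps, seat g1-p1 (with g1-plan-2's SK-D1c), 2026-08-22; imports the two `Gaps` kernel files + `Beta.CombOneShotJets` (for `JcOf`) + g1-p2's `Gaps.D4Residue` (for the joint END) only; no existing file touched.
-/

noncomputable section

open Finset
open scoped BigOperators
open Literature.MathematicalPhysics.QuantumFieldTheory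
open Literature.MathematicalPhysics.QuantumFieldTheory.Balaban1983to89
open Literature.MathematicalPhysics.QuantumFieldTheory.Balaban1983to89.Beta
open OneStepResolventKernel (JetData)
open OneStepKernelFamily (TbalOf TshotOf D1Tel D1Rep D1Drift flipK)
open B12Beta (secondMoment)
open Drift (OneLoopDrift)
open ScalewiseVectorSeam (oneShotSide)
open PolarizationSign (WardTransversal AxisReflectionCovariant)
open FlowStep FlowStepRuns DagBinding
open RemainderChain (RemainderConst)
open RemainderResidue (AtSlope)
open VectorTailsLoc (fam kfam)
open VectorLegVolumeAdapter (MvE)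
open Summit.QuantumFields.BalabanUV.Beta.CombChartJointEnd (JsB12CombShSym)
open Summit.QuantumFields.BalabanUV.Beta.SymSecondOrderTablesAn1 (symTablesAn1S2)
open Summit.QuantumFields.BalabanUV.Beta.CombOneShotJets (JcOf)

namespace Summit.QuantumFields.BalabanUV.Gaps.D1Residue

variable {Lc : ℕ} [NeZero Lc] {L : Type*}

/-! ## §1 The four predicates (over jet parameters; never facts) -/

/-- **BOUNDED CUMULATIVE READ-OUT DEFECT** (the `O(1)`-tolerant telescoping clause of (D1); WORK-bound composition algebra for OUR typed objects — road FP):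
the partial sums of the step coefficients `β⁰_j := secondMoment (TbalOf Lc Js j) μ ν` stay within a uniform constant of the one-shot coefficient of the
`m`-step composite system, `∃ U′, ∀ m ≥ 1, |Σ_{j<m} β⁰_j − secondMoment (TshotOf Lc Jc m) μ ν| ≤ U′`.  A predicate over the jet parameters, never a fact. [folklore] -/
def ReadoutBdd (Lc : ℕ) [NeZero Lc] (Js : ℕ → JetData 3 Lc) (Jc : ∀ m : ℕ, JetData 3 (Lc ^ m)) (μ ν : Fin 4) : Prop :=
  ∃ U' : ℝ, ∀ m : ℕ, 1 ≤ m → |∑ j ∈ range m, secondMoment (TbalOf Lc Js j) μ ν - secondMoment (TshotOf Lc Jc m) μ ν| ≤ U'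

/-- **THE ONE-SHOT ONE-LOOP LAW** (the scheme-free analytic residue of (D1) = THE EXACT MISSING LEMMA of row (D1)): for composite (one-shot) jet data `Jc`,
the (1.22) second moment of the one-shot kernel of the `m`-step composite system (block `Lc^m`) runs with the asymptotic-freedom slope,
`∃ U, ∀ m ≥ 1, |secondMoment (TshotOf Lc Jc m) μ ν − m · stepBal N Lc| ≤ U` (`stepBal N L = (11N²/12π²)·log L`).  For Bałaban's jets: the located UNPRINTED
one-loop computation behind [B12] Theorem 2 (p. 259).  A predicate over the jet parameters, NEVER a fact. [folklore] -/
def OneShotLaw (Lc : ℕ) [NeZero Lc] (Jc : ∀ m : ℕ, JetData 3 (Lc ^ m)) (N : ℝ) (μ ν : Fin 4) : Prop :=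
  ∃ U : ℝ, ∀ m : ℕ, 1 ≤ m → |secondMoment (TshotOf Lc Jc m) μ ν - B12Normalization.stepBal N Lc * m| ≤ U

/-- **THE RESIDUE OF (D1) AS ONE `Prop`**: some composite jet family telescopes onto the step family up to `O(1)` AND obeys the one-shot law.  Sufficient for
`D1Drift` (`d1Drift_of_residue`) and, given any telescoping partner, necessary (`residue_iff`).  A predicate, never a fact. [folklore] -/
def Residue (Lc : ℕ) [NeZero Lc] (Js : ℕ → JetData 3 Lc) (N : ℝ) (μ ν : Fin 4) : Prop :=
  ∃ Jc : ∀ m : ℕ, JetData 3 (Lc ^ m), ReadoutBdd Lc Js Jc μ ν ∧ OneShotLaw Lc Jc N μ ν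

/-- **g1-plan-2's Jc-FREE SCALAR (SK-D1c, verbatim shape over a real sequence `β0`)**: the partial sums `Σ_{j<m} β0 j` track the FREE infinite-volume one-shot
sums `oneShotSide` at the blocking scales `Lc^m`, uniformly in `m` — `∃ U, ∀ m ≥ 1, |Σ_{j<m} β0 j − oneShotSide SL μ ν N a k (Lc^m)| ≤ U` (the skeleton's
`composedCoeff (fun j _ => β0 j) m` IS this partial sum, `HidentScalewise.composedCoeff_trivial`).  For `β0 := secondMoment ∘ TbalOf Lc Js` it is (D1)'s END-grade
content: (D1) ⟺ `D1Cum` modulo the two printed [B5] statements (`d1Drift_iff_d1Cum`).  A hypothesis shape, never a fact. [folklore] -/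
def D1Cum (Lc : ℕ) (β0 : ℕ → ℝ) (N : ℝ) (μ ν : Fin 4) (a : ℝ) (SL : Finset L) (k : L → Fin 4) : Prop :=
  ∃ U : ℝ, ∀ m : ℕ, 1 ≤ m → |∑ j ∈ range m, β0 j - oneShotSide SL μ ν N a k (Lc ^ m)| ≤ U

/-! ## §2 Two out of three; the residue; the log form -/

/-- [folklore] **`ReadoutBdd` ∧ `OneShotLaw` ⟹ (D1)** (generic; no printed input, no symmetry, no window). -/
theorem d1Drift_of_readoutBdd_oneShotLaw (Js : ℕ → JetData 3 Lc) (Jc : ∀ m : ℕ, JetData 3 (Lc ^ m)) {N : ℝ} {μ ν : Fin 4}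
    (hbdd : ReadoutBdd Lc Js Jc μ ν) (hlaw : OneShotLaw Lc Jc N μ ν) : D1Drift Lc Js N μ ν :=
  D1BinderEnds.d1Drift_of_readoutBdd_oneShotLaw Js Jc hbdd hlaw

/-- [folklore] **(D1) ∧ `ReadoutBdd` ⟹ `OneShotLaw`.** -/
theorem oneShotLaw_of_d1Drift_readoutBdd (Js : ℕ → JetData 3 Lc) (Jc : ∀ m : ℕ, JetData 3 (Lc ^ m)) {N : ℝ} {μ ν : Fin 4}
    (hD : D1Drift Lc Js N μ ν) (hbdd : ReadoutBdd Lc Js Jc μ ν) : OneShotLaw Lc Jc N μ ν :=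
  D1BinderEnds.oneShotLaw_of_d1Drift_readoutBdd Js Jc hD hbdd

/-- [folklore] **(D1) ∧ `OneShotLaw` ⟹ `ReadoutBdd`.** -/
theorem readoutBdd_of_d1Drift_oneShotLaw (Js : ℕ → JetData 3 Lc) (Jc : ∀ m : ℕ, JetData 3 (Lc ^ m)) {N : ℝ} {μ ν : Fin 4}
    (hD : D1Drift Lc Js N μ ν) (hlaw : OneShotLaw Lc Jc N μ ν) : ReadoutBdd Lc Js Jc μ ν :=
  D1BinderEnds.readoutBdd_of_d1Drift_oneShotLaw Js Jc hD hlaw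

/-- [folklore] **EXACTNESS**: given a telescoping partner `Jc`, `D1Drift Lc Js N μ ν ⟺ OneShotLaw Lc Jc N μ ν`. -/
theorem d1Drift_iff_oneShotLaw_of_readoutBdd (Js : ℕ → JetData 3 Lc) (Jc : ∀ m : ℕ, JetData 3 (Lc ^ m)) {N : ℝ} {μ ν : Fin 4}
    (hbdd : ReadoutBdd Lc Js Jc μ ν) : D1Drift Lc Js N μ ν ↔ OneShotLaw Lc Jc N μ ν :=
  D1BinderEnds.d1Drift_iff_oneShotLaw_of_readoutBdd Js Jc hbdd

/-- [folklore] **`Residue ⟹ (D1)`.** -/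
theorem d1Drift_of_residue (Js : ℕ → JetData 3 Lc) {N : ℝ} {μ ν : Fin 4} (h : Residue Lc Js N μ ν) : D1Drift Lc Js N μ ν := by
  obtain ⟨Jc, hbdd, hlaw⟩ := h
  exact d1Drift_of_readoutBdd_oneShotLaw Js Jc hbdd hlaw

/-- [folklore] **`Residue ⟺ (D1) ∧ ∃ Jc, ReadoutBdd`.** -/
theorem residue_iff (Js : ℕ → JetData 3 Lc) (N : ℝ) (μ ν : Fin 4) :
    Residue Lc Js N μ ν ↔ D1Drift Lc Js N μ ν ∧ ∃ Jc : ∀ m : ℕ, JetData 3 (Lc ^ m), ReadoutBdd Lc Js Jc μ ν :=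
  ⟨fun h => ⟨d1Drift_of_residue Js h, h.imp fun _ hJ => hJ.1⟩,
    fun ⟨hD, Jc, hbdd⟩ => ⟨Jc, hbdd, oneShotLaw_of_d1Drift_readoutBdd Js Jc hD hbdd⟩⟩

/-- [folklore] **THE RESIDUE FEEDS THE SPINE'S CONSUMER**: `Residue` + the identification `hβ : Sβ.β0 j = secondMoment (TbalOf Lc Js j) μ ν` + the printed remainder
constant (D4) with `rr ≤ stepBal N Lc` + continuity (C) ⟹ `EndpointExistence Cn` (`OneStepKernelFamily.endpointExistence_of_D1Drift` ∘ `d1Drift_of_residue`) — the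
END-grade use of (D1) on the L1.2 path, with (D1) replaced by its residue.  Discharges nothing by itself. -/
theorem endpointExistence_of_residue {β : HBeta} {Cn : B12.Construction} (hgen : ForwardGenerated Cn β) (Sβ : B12Beta.OneLoopSplit β)
    (Js : ℕ → JetData 3 Lc) {N : ℝ} {μ ν : Fin 4} (hβ : ∀ j, Sβ.β0 j = secondMoment (TbalOf Lc Js j) μ ν) (h : Residue Lc Js N μ ν)
    {rr γ₀ : ℝ} (hγ₀ : 0 < γ₀) (hrem : RemainderConst Sβ γ₀ rr) (hr : rr ≤ B12Normalization.stepBal N Lc) (hcont : BetaContH γ₀ β) :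
    EndpointExistence Cn :=
  OneStepKernelFamily.endpointExistence_of_D1Drift hgen Sβ Js hβ (d1Drift_of_residue Js h) hγ₀ hrem hr hcont

/-- [folklore] `OneShotLaw` ⟺ its `log (Lc^m)` form. -/
theorem oneShotLaw_iff_log_form (Jc : ∀ m : ℕ, JetData 3 (Lc ^ m)) (N : ℝ) (μ ν : Fin 4) :
    OneShotLaw Lc Jc N μ ν ↔
      ∃ U : ℝ, ∀ m : ℕ, 1 ≤ m → |secondMoment (TshotOf Lc Jc m) μ ν - B12Normalization.stepBal N ((Lc : ℝ) ^ m)| ≤ U :=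
  D1BinderEnds.oneShotLaw_iff_log_form Jc N μ ν

/-- [folklore] **`D1Tel` (+ hW, hR) ⟹ `ReadoutBdd`** (exact read-out identity, `Gaps.D1CumJcFree.readout_eq_of_D1Tel`). -/
theorem readoutBdd_of_D1Tel (Js : ℕ → JetData 3 Lc) (Jc : ∀ m : ℕ, JetData 3 (Lc ^ m))
    (hW : ∀ j, WardTransversal (flipK (TbalOf Lc Js j))) (hR : ∀ j, AxisReflectionCovariant (flipK (TbalOf Lc Js j)))
    (htel : D1Tel Lc Js Jc) (μ ν : Fin 4) : ReadoutBdd Lc Js Jc μ ν :=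
  D1CumJcFree.readoutBdd_of_D1Tel Js Jc hW hR htel μ ν

/-! ## §3 Under the two PRINTED [B5] statements BY NAME: `OneShotLaw ⟺ D1Rep`, (D1) ⟺ `D1Cum` -/

/-- [folklore] **`OneShotLaw ⟺ D1Rep`** under the two PRINTED [B5] statements BY NAME (and labels, window, `μ ≠ ν`, `N ≠ 0`, `2 ≤ Lc`). -/
theorem oneShotLaw_iff_d1Rep (a : ℝ) (ha : 0 < a)
    (h12 : B5.Prop12Printed (fam (fun i : ℕ+ × ℕ => ((i.1 : ℕ+) : ℕ)) (fun i => i.1.pos) MvE a ha))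
    (h126 : B5.Kernel126_127Printed (kfam (fun i : ℕ+ × ℕ => ((i.1 : ℕ+) : ℕ)) MvE))
    {SL : Finset L} (hSL : SL.Nonempty) (k : L → Fin 4) {μ ν : Fin 4} (hμν : μ ≠ ν) {N : ℝ} (hN : N ≠ 0) (hL : 2 ≤ Lc)
    {cc : ℝ} {M : ℕ → ℕ} (hc : 1 ≤ cc) (hM : ∀ L : ℕ, 2 ≤ L → 1 ≤ M L ∧ (L : ℝ) ≤ cc * M L) (hML : ∀ L : ℕ, 2 ≤ L → M L ≤ L)
    (Jc : ∀ m : ℕ, JetData 3 (Lc ^ m)) : OneShotLaw Lc Jc N μ ν ↔ D1Rep Lc Jc N μ ν a SL k :=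
  D1BinderEnds.oneShotLaw_iff_d1Rep a ha h12 h126 hSL k hμν hN hL hc hM hML Jc

/-- [folklore] **(D1) ⟺ `D1Cum`** under the two PRINTED [B5] statements BY NAME (g1-plan-2 SK-D1c; any step jets; labels, window, `μ ≠ ν`, `N ≠ 0`, `2 ≤ Lc`). -/
theorem d1Drift_iff_d1Cum (a : ℝ) (ha : 0 < a)
    (h12 : B5.Prop12Printed (fam (fun i : ℕ+ × ℕ => ((i.1 : ℕ+) : ℕ)) (fun i => i.1.pos) MvE a ha))
    (h126 : B5.Kernel126_127Printed (kfam (fun i : ℕ+ × ℕ => ((i.1 : ℕ+) : ℕ)) MvE))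
    {SL : Finset L} (hSL : SL.Nonempty) (k : L → Fin 4) {μ ν : Fin 4} (hμν : μ ≠ ν) {N : ℝ} (hN : N ≠ 0) (hL : 2 ≤ Lc) (Js : ℕ → JetData 3 Lc)
    {cc : ℝ} {M : ℕ → ℕ} (hc : 1 ≤ cc) (hM : ∀ L : ℕ, 2 ≤ L → 1 ≤ M L ∧ (L : ℝ) ≤ cc * M L) (hML : ∀ L : ℕ, 2 ≤ L → M L ≤ L) :
    D1Drift Lc Js N μ ν ↔ D1Cum Lc (fun j => secondMoment (TbalOf Lc Js j) μ ν) N μ ν a SL k :=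
  D1CumJcFree.d1Drift_iff_d1Cum a ha h12 h126 hSL k hμν hN hL Js hc hM hML

/-- [folklore] **`ReadoutBdd ∧ D1Rep ⟹ D1Cum`** (no printed input) and **`D1Cum ∧ ReadoutBdd ⟹ D1Rep`**: the composite family's representation binder and the
Jc-free scalar are interchangeable across a telescoping partner. -/
theorem d1Cum_iff_d1Rep_of_readoutBdd (Js : ℕ → JetData 3 Lc) (Jc : ∀ m : ℕ, JetData 3 (Lc ^ m)) {N : ℝ} {μ ν : Fin 4} {a : ℝ} {SL : Finset L}
    {k : L → Fin 4} (hbdd : ReadoutBdd Lc Js Jc μ ν) :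
    D1Cum Lc (fun j => secondMoment (TbalOf Lc Js j) μ ν) N μ ν a SL k ↔ D1Rep Lc Jc N μ ν a SL k :=
  ⟨fun hcum => D1CumJcFree.d1Rep_of_d1Cum_readoutBdd Js Jc hcum hbdd, fun hrep => D1CumJcFree.d1Cum_of_readoutBdd_D1Rep Js Jc hbdd hrep⟩

/-! ## §4 At the literal of record -/

/-- [folklore] **`Residue ⟹ (D1)` AT THE LITERAL OF RECORD** (any table parameters `cΛ`, `cB`; at the locks `2/Lc⁴`, `−Lc¹²/4` this is row D1's literal). -/
theorem d1Drift_record_of_residue (hLc : Odd Lc) (N : ℕ) (cΛ cB : ℝ) {Nc : ℝ} {μ ν : Fin 4}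
    (h : Residue Lc (JsB12CombShSym hLc N (symTablesAn1S2 3 Lc cΛ) cΛ cB) Nc μ ν) :
    D1Drift Lc (JsB12CombShSym hLc N (symTablesAn1S2 3 Lc cΛ) cΛ cB) Nc μ ν :=
  d1Drift_of_residue _ h

/-- [folklore] **EXACTNESS AT THE LITERAL OF RECORD**: for every telescoping partner `Jc` of the step jets of record, (D1) ⟺ `OneShotLaw Lc Jc Nc μ ν`. -/
theorem d1Drift_record_iff_oneShotLaw_of_readoutBdd (hLc : Odd Lc) (N : ℕ) (cΛ cB : ℝ) {Nc : ℝ} {μ ν : Fin 4} (Jc : ∀ m : ℕ, JetData 3 (Lc ^ m))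
    (hbdd : ReadoutBdd Lc (JsB12CombShSym hLc N (symTablesAn1S2 3 Lc cΛ) cΛ cB) Jc μ ν) :
    D1Drift Lc (JsB12CombShSym hLc N (symTablesAn1S2 3 Lc cΛ) cΛ cB) Nc μ ν ↔ OneShotLaw Lc Jc Nc μ ν :=
  d1Drift_iff_oneShotLaw_of_readoutBdd _ Jc hbdd

/-- [folklore] **`D1Tel ∧ OneShotLaw` ∧ printed [B5] ⟹ (D1) AT THE PINNED JETS** (locks instantiated): the one-shot law turned into `D1Rep` (`oneShotLaw_iff_d1Rep`,
window `M := id`) and fed to ROOT M‴ (`Gaps.D1BinderEnds.d1Drift_record_of_D1Tel_D1Rep`); displayed: `D1Tel`, `OneShotLaw`, the two printed statements, labels,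
`μ ≠ ν`, `Nc ≠ 0`, `Odd Lc`, `2 ≤ Lc`, `2 ≤ N`. -/
theorem d1Drift_record_of_D1Tel_oneShotLaw (hLc : Odd Lc) (hL2 : 2 ≤ Lc) {N : ℕ} (hN : 2 ≤ N) (a : ℝ) (ha : 0 < a)
    (h12 : B5.Prop12Printed (fam (fun i : ℕ+ × ℕ => ((i.1 : ℕ+) : ℕ)) (fun i => i.1.pos) MvE a ha))
    (h126 : B5.Kernel126_127Printed (kfam (fun i : ℕ+ × ℕ => ((i.1 : ℕ+) : ℕ)) MvE))
    {SL : Finset L} (hSL : SL.Nonempty) (k : L → Fin 4) {μ ν : Fin 4} (hμν : μ ≠ ν) {Nc : ℝ} (hNc : Nc ≠ 0)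
    (Jc : ∀ m : ℕ, JetData 3 (Lc ^ m))
    (htel : D1Tel Lc (JsB12CombShSym hLc N (symTablesAn1S2 3 Lc (2 / (Lc : ℝ) ^ 4)) (2 / (Lc : ℝ) ^ 4) (-((Lc : ℝ) ^ 12 / 4))) Jc)
    (hlaw : OneShotLaw Lc Jc Nc μ ν) :
    D1Drift Lc (JsB12CombShSym hLc N (symTablesAn1S2 3 Lc (2 / (Lc : ℝ) ^ 4)) (2 / (Lc : ℝ) ^ 4) (-((Lc : ℝ) ^ 12 / 4))) Nc μ ν :=
  D1BinderEnds.d1Drift_record_of_D1Tel_D1Rep hLc hL2 hN a ha h12 h126 hSL k hμν hNc Jc htel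
    ((oneShotLaw_iff_d1Rep a ha h12 h126 hSL k hμν hNc hL2 (cc := 1) (M := fun n => n) le_rfl D1BinderEnds.window_id D1BinderEnds.window_id_le Jc).mp hlaw)

/-- [folklore] **THE RECORD END IN THE Jc-FREE CURRENCY, BY NAME**: `D1Cum` for the record coefficients ∧ the two printed [B5] statements ∧ labels ∧ `μ ≠ ν`, `Nc ≠ 0`,
`2 ≤ Lc` ⟹ (D1) (any table parameters). -/
theorem d1Drift_record_of_d1Cum (hLc : Odd Lc) (hL2 : 2 ≤ Lc) (N : ℕ) (cΛ cB : ℝ) (a : ℝ) (ha : 0 < a)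
    (h12 : B5.Prop12Printed (fam (fun i : ℕ+ × ℕ => ((i.1 : ℕ+) : ℕ)) (fun i => i.1.pos) MvE a ha))
    (h126 : B5.Kernel126_127Printed (kfam (fun i : ℕ+ × ℕ => ((i.1 : ℕ+) : ℕ)) MvE))
    {SL : Finset L} (hSL : SL.Nonempty) (k : L → Fin 4) {μ ν : Fin 4} (hμν : μ ≠ ν) {Nc : ℝ} (hNc : Nc ≠ 0)
    (hcum : D1Cum Lc (fun j => secondMoment (TbalOf Lc (JsB12CombShSym hLc N (symTablesAn1S2 3 Lc cΛ) cΛ cB) j) μ ν) Nc μ ν a SL k) :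
    D1Drift Lc (JsB12CombShSym hLc N (symTablesAn1S2 3 Lc cΛ) cΛ cB) Nc μ ν :=
  D1CumJcFree.d1Drift_record_of_d1Cum hLc hL2 N cΛ cB a ha h12 h126 hSL k hμν hNc hcum

/-- [folklore] **THE EXACT MISSING LEMMA, FULLY PINNED** (no free jet family left): at the composite one-shot jets OF RECORD `JcOf hLc N cΛ' cB'` (row-D1 owner an2's
`Beta.CombOneShotJets.JcOf` = the (III′) literal's level-0 member at blocking `Lc^m`, lock numerals `cΛ' cB' : ℕ → ℝ` free functions of the scale), for every bounded
read-out defect of the step jets of record onto them ((RB) — road FP's telescoping in `O(1)` currency), (D1) ⟺ `OneShotLaw Lc (JcOf hLc N cΛ' cB') Nc μ ν`: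
«the (1.22) second moment of the one-shot kernel of the (III′) literal at blocking `Lc^m` equals `m · (11Nc²/12π²) · log Lc + O(1)`» — located, UNPRINTED, proved nowhere. -/
theorem d1Drift_record_iff_oneShotLaw_JcOf (hLc : Odd Lc) (N : ℕ) (cΛ cB : ℝ) (cΛ' cB' : ℕ → ℝ) {Nc : ℝ} {μ ν : Fin 4}
    (hbdd : ReadoutBdd Lc (JsB12CombShSym hLc N (symTablesAn1S2 3 Lc cΛ) cΛ cB) (JcOf hLc N cΛ' cB') μ ν) :
    D1Drift Lc (JsB12CombShSym hLc N (symTablesAn1S2 3 Lc cΛ) cΛ cB) Nc μ ν ↔ OneShotLaw Lc (JcOf hLc N cΛ' cB') Nc μ ν :=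
  d1Drift_iff_oneShotLaw_of_readoutBdd _ _ hbdd

/-- [folklore] **… AND ITS UNCONDITIONAL HALF**: `ReadoutBdd` onto `JcOf` ∧ `OneShotLaw` at `JcOf` ⟹ (D1) at the literal of record — the cell's row (D1) in two named clauses,
both about OUR pinned objects, nothing else displayed. -/
theorem d1Drift_record_of_readoutBdd_oneShotLaw_JcOf (hLc : Odd Lc) (N : ℕ) (cΛ cB : ℝ) (cΛ' cB' : ℕ → ℝ) {Nc : ℝ} {μ ν : Fin 4}
    (hbdd : ReadoutBdd Lc (JsB12CombShSym hLc N (symTablesAn1S2 3 Lc cΛ) cΛ cB) (JcOf hLc N cΛ' cB') μ ν)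
    (hlaw : OneShotLaw Lc (JcOf hLc N cΛ' cB') Nc μ ν) :
    D1Drift Lc (JsB12CombShSym hLc N (symTablesAn1S2 3 Lc cΛ) cΛ cB) Nc μ ν :=
  d1Drift_of_readoutBdd_oneShotLaw _ _ hbdd hlaw

/-- [folklore] **JOINT END WITH ROW (D4)'s RESIDUE (g1-p2, `Gaps.D4Residue` ∕ `Beta.RemainderResidue.AtSlope`)**: `Residue` (row D1's, this file) + the identification `hβ` +
`AtSlope Sβ γ₀ (stepBal N Lc)` (row D4's named residue at the one-loop slope) + continuity (C) ⟹ `EndpointExistence Cn` — the cell's reading of «BetaPertH ⇐ (D1) ∧ (D4) ∧ …»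
at END grade with BOTH binders replaced by their named residues (`Gaps.D4Residue.endpointExistence_of_D1Drift_atSlope` ∘ `d1Drift_of_residue`).  Discharges nothing. -/
theorem endpointExistence_of_residue_atSlope {β : HBeta} {Cn : B12.Construction} (hgen : ForwardGenerated Cn β) (Sβ : B12Beta.OneLoopSplit β)
    (Js : ℕ → JetData 3 Lc) {N : ℝ} {μ ν : Fin 4} (hβ : ∀ j, Sβ.β0 j = secondMoment (TbalOf Lc Js j) μ ν) (h : Residue Lc Js N μ ν)
    {γ₀ : ℝ} (hγ₀ : 0 < γ₀) (hres : AtSlope Sβ γ₀ (B12Normalization.stepBal N Lc)) (hcont : BetaContH γ₀ β) : EndpointExistence Cn :=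
  D4Residue.endpointExistence_of_D1Drift_atSlope hgen Sβ Js hβ (d1Drift_of_residue Js h) hγ₀ hres hcont

/-! ## §5 Rigidity of the slope: a drifting sequence has exactly one slope -/

/-- [folklore] **A SEQUENCE DRIFTS WITH AT MOST ONE SLOPE**: `OneLoopDrift b A β0 ∧ OneLoopDrift b' A' β0 ⟹ b = b'` (`|k·(b − b')| ≤ A + A'` for all `k`, Archimedes).
Hence (D1) PINS the one-loop number: a step family whose coefficients drifted with any slope other than `stepBal N Lc = (11N²/12π²)·log Lc` would REFUTE (D1). -/
theorem oneLoopDrift_slope_unique {b b' A A' : ℝ} {β0 : ℕ → ℝ} (h : OneLoopDrift b A β0) (h' : OneLoopDrift b' A' β0) : b = b' := by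
  by_contra hne
  have hpos : 0 < |b - b'| := abs_pos.mpr (sub_ne_zero.mpr hne)
  have hbd : ∀ k : ℕ, (k : ℝ) * |b - b'| ≤ A + A' := fun k => by
    have e : (k : ℝ) * (b - b') = (∑ j ∈ range k, β0 j - b' * k) - (∑ j ∈ range k, β0 j - b * k) := by ring
    calc (k : ℝ) * |b - b'| = |(k : ℝ) * (b - b')| := by rw [abs_mul, Nat.abs_cast]
      _ = |(∑ j ∈ range k, β0 j - b' * k) - (∑ j ∈ range k, β0 j - b * k)| := by rw [e]
      _ ≤ |∑ j ∈ range k, β0 j - b' * k| + |∑ j ∈ range k, β0 j - b * k| := abs_sub _ _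
      _ ≤ A' + A := add_le_add (h' k) (h k)
      _ = A + A' := add_comm _ _
  obtain ⟨k, hk⟩ := exists_nat_gt ((A + A') / |b - b'|)
  have := hbd k
  rw [div_lt_iff₀ hpos] at hk
  linarith

/-- [folklore] **(D1) PINS ITS SLOPE**: if the step coefficients drift with slope `stepBal N Lc` ((D1)) and also with some slope `b`, then `b = stepBal N Lc`. -/
theorem d1Drift_slope_unique (Js : ℕ → JetData 3 Lc) {N : ℝ} {μ ν : Fin 4} (hD : D1Drift Lc Js N μ ν) {b A : ℝ}
    (hb : OneLoopDrift b A (fun j => secondMoment (TbalOf Lc Js j) μ ν)) : b = B12Normalization.stepBal N Lc := by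
  obtain ⟨A₀, hA₀⟩ := hD
  exact oneLoopDrift_slope_unique hb hA₀

/-- [folklore] **(D1) DETERMINES THE COLOUR NUMERAL UP TO SIGN**: the group parameter `N` of the jets and the numeral `Nc` of the slope are independent arguments of
`D1Drift`; if the SAME step coefficients drift with the slopes of two numerals `Nc`, `Nc'` (block `Lc ≥ 2`), then `Nc² = Nc'²` — so for a given step family at most one
value of `Nc²` can make (D1) true, and the identification of that value with the colour content of the jets is part of the wall, not of the bookkeeping. -/
theorem d1Drift_colour_sq_unique (Js : ℕ → JetData 3 Lc) {Nc Nc' : ℝ} {μ ν : Fin 4} (hL : 2 ≤ Lc)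
    (h : D1Drift Lc Js Nc μ ν) (h' : D1Drift Lc Js Nc' μ ν) : Nc ^ 2 = Nc' ^ 2 := by
  obtain ⟨A, hA⟩ := h
  obtain ⟨A', hA'⟩ := h'
  have hs : 11 * Nc ^ 2 / (12 * Real.pi ^ 2) * Real.log (Lc : ℝ) = 11 * Nc' ^ 2 / (12 * Real.pi ^ 2) * Real.log (Lc : ℝ) := by
    rw [← B12Normalization.stepBal_eq, ← B12Normalization.stepBal_eq]
    exact oneLoopDrift_slope_unique hA hA'
  have hlog : 0 < Real.log (Lc : ℝ) := Real.log_pos (by exact_mod_cast (by omega : 1 < Lc))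
  have h1 : 11 * Nc ^ 2 / (12 * Real.pi ^ 2) = 11 * Nc' ^ 2 / (12 * Real.pi ^ 2) := mul_right_cancel₀ hlog.ne' hs
  have hπ : (0 : ℝ) < 12 * Real.pi ^ 2 := by positivity
  rw [div_eq_div_iff hπ.ne' hπ.ne'] at h1
  nlinarith [h1, hπ]

end Summit.QuantumFields.BalabanUV.Gaps.D1Residue

end
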